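import Literature.NumberTheory.Sieve.CFSemigroupLipGap
import Literature.NumberTheory.Sieve.CFSemigroupLipHolomorphic
import HarnessLib

/-!
# The resolvent `(1 - L_s)^{-1}` near `s = δ_A`: the simple pole

Support file (all results proved) for the named fact
`Literature.NumberTheory.Sieve.MageeOhWinter2019_uniformCounting` (`CFSemigroupCounting.lean`).
The Laplace transform of the renewal counting function of [MageeOhWinter2019, §3] is expressed
through the resolvent `Σ_n L_sⁿ = (1 - L_s)^{-1}` ([MageeOhWinter2019, (3.5)–(3.7)]; Lalley's
renewal theorem); its leading singularity is a simple pole at `s = δ` produced by the simple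
leading eigenvalue `λ(s)` of `L_s` (`λ(δ) = 1`), with residue a multiple of the spectral projection
`Π = h ⊗ ν` ([MageeOhWinter2019, Prop. 17]: `N(a, x) ~ C(x) e^{δ a}` with `C ∝ h(x)`). On the
Lipschitz space `CfLip` we prove this operator-theoretically, by a rank-one (Sherman–Morrison)
perturbation argument around `L_δ = Π + Q` (`CFSemigroupLipGap.lean`) combined with the
holomorphy of `s ↦ L_s` (`CFSemigroupLipHolomorphic.lean`):

* `cfW s = 1 + Π - L_s` (entire, a unit near `δ`, `cfW δ = 1 - Q`), `cfAinv s = (cfW s)^{-1}`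
  (analytic near `δ`, `cfAinv δ = R₀`), `cfM s = ν(cfAinv s h)` (analytic, `cfM δ = 1`);
* `cfRes_inverse`: for `cfW s` a unit and `cfM s ≠ 1`,
  `cfRes s = (1 + (1 - cfM s)^{-1} ν ⊗ (cfAinv s h)) cfAinv s` is a two-sided inverse of `1 - L_s`;
* `cfResolvent_pole`: if `m'(δ) = deriv cfM δ ≠ 0`, there are `ε > 0` and an operator-valued
  function `W_reg`, analytic on the ball `B(δ, ε)`, such that for `0 < |s - δ| < ε` the operator
  `1 - L_s` is invertible with inverse `W_reg(s) - ((s - δ) m'(δ))^{-1} Π` — a simple pole at `δ`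
  with residue `-m'(δ)^{-1} Π`. (`m'(δ) ≠ 0`, indeed `m'(δ) < 0`, is proved separately.)
  [cite: MageeOhWinter2019, Prop. 17]

## References

* M. Magee, H. Oh, D. Winter, J. reine angew. Math. 753 (2019) 89–135, §3.4, Prop. 17.
  [MageeOhWinter2019]
* S. P. Lalley, Acta Math. 163 (1989) 1–55, §2 (renewal theorem via the resolvent of `L_s`).
-/

noncomputable section

open Set Filter Metric
open scoped Topology

namespace Literature.NumberTheory.Sieve

variable {A : Finset ℕ}

/-! ### Rank-one perturbations of the identity (Sherman–Morrison) -/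

section RankOne

variable {E : Type*} [NormedAddCommGroup E] [NormedSpace ℂ E]

/-- The square of a rank-one operator: `(φ ⊗ u)² = φ(u) (φ ⊗ u)`. [folklore] -/
theorem smulRight_mul_smulRight (φ : E →L[ℂ] ℂ) (u : E) :
    φ.smulRight u * φ.smulRight u = (φ u) • φ.smulRight u := by
  refine ContinuousLinearMap.ext fun x => ?_
  show φ.smulRight u (φ.smulRight u x) = (φ u) • (φ.smulRight u x)
  rw [ContinuousLinearMap.smulRight_apply, ContinuousLinearMap.smulRight_apply, map_smul, smul_eq_mul,
    smul_smul, mul_comm]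

/-- **Sherman–Morrison for rank-one perturbations of the identity:** if `φ(u) ≠ 1` then
`1 + (1 - φ u)⁻¹ (φ ⊗ u)` is a two-sided inverse of `1 - φ ⊗ u`. [folklore] -/
theorem one_sub_smulRight_inverse (φ : E →L[ℂ] ℂ) (u : E) (h : φ u ≠ 1) :
    (1 - φ.smulRight u) * (1 + (1 - φ u)⁻¹ • φ.smulRight u) = 1 ∧
      (1 + (1 - φ u)⁻¹ • φ.smulRight u) * (1 - φ.smulRight u) = 1 := by
  set S := φ.smulRight u with hSdef
  set c : ℂ := (1 - φ u)⁻¹ with hcdef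
  have hS : S * S = (φ u) • S := smulRight_mul_smulRight φ u
  have hc : c * (1 - φ u) = 1 := inv_mul_cancel₀ (sub_ne_zero.2 (Ne.symm h))
  have key : c - 1 - c * φ u = 0 := by linear_combination hc
  constructor
  · have e1 : (1 - S) * (1 + c • S) = 1 + ((c - 1 - c * φ u) • S) := by
      rw [sub_mul, one_mul, mul_add, mul_one, mul_smul_comm, hS, smul_smul, sub_smul, sub_smul, one_smul]
      abel
    rw [e1, key, zero_smul, add_zero]
  · have e2 : (1 + c • S) * (1 - S) = 1 + ((c - 1 - c * φ u) • S) := by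
      rw [add_mul, one_mul, mul_sub, mul_one, smul_mul_assoc, hS, smul_smul, sub_smul, sub_smul, one_smul]
      abel
    rw [e2, key, zero_smul, add_zero]

end RankOne

/-! ### `W(s) = 1 + Π - L_s`, its inverse `A(s)`, and `m(s) = ν(A(s) h)` -/

section Pole

variable (A) (hA : ∀ a ∈ A, 1 ≤ a) (h2 : 2 ≤ A.card)
include hA h2

/-- `W(s) = 1 + Π - L_s` (so that `1 - L_s = W(s) - Π` and `W(δ) = 1 - Q`). [folklore] -/
def cfW (s : ℂ) : CfLip →L[ℂ] CfLip := 1 + cfPi A hA h2 - cfLOp A hA s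

/-- `W(δ) = 1 - Q`. [folklore] -/
theorem cfW_delta : cfW A hA h2 (cfDimension A : ℂ) = 1 - cfQδ A hA h2 := by
  rw [cfW, cfQδ]
  abel

/-- `1 - L_s = W(s) - Π`. [folklore] -/
theorem one_sub_cfLOp_eq (s : ℂ) : 1 - cfLOp A hA s = cfW A hA h2 s - cfPi A hA h2 := by
  rw [cfW]
  abel

/-- `s ↦ W(s)` is entire. [folklore] -/
theorem analyticAt_cfW (s : ℂ) : AnalyticAt ℂ (cfW A hA h2) s := by
  show AnalyticAt ℂ (fun s => (1 : CfLip →L[ℂ] CfLip) + cfPi A hA h2 - cfLOp A hA s) s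
  exact analyticAt_const.sub (analyticAt_cfLOp A hA s)

/-- `W(δ)` is a unit. [folklore] -/
theorem isUnit_cfW_delta : IsUnit (cfW A hA h2 (cfDimension A : ℂ)) := by
  rw [cfW_delta]
  exact isUnit_one_sub_cfQδ A hA h2

/-- `W(s)` is a unit for `s` near `δ` (units are open). [folklore] -/
theorem eventually_isUnit_cfW : ∀ᶠ s in 𝓝 (cfDimension A : ℂ), IsUnit (cfW A hA h2 s) :=
  (analyticAt_cfW A hA h2 _).continuousAt.preimage_mem_nhds
    (Units.isOpen.mem_nhds (isUnit_cfW_delta A hA h2))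

/-- `A(s) = W(s)^{-1}` (the ring inverse; the genuine inverse where `W(s)` is a unit). [folklore] -/
def cfAinv (s : ℂ) : CfLip →L[ℂ] CfLip := Ring.inverse (cfW A hA h2 s)

/-- `A(δ) = R₀ = Σ Qⁿ`. [folklore] -/
theorem cfAinv_delta : cfAinv A hA h2 (cfDimension A : ℂ) = cfR0 A hA h2 := by
  rw [cfAinv, cfW_delta, ringInverse_one_sub_cfQδ]

/-- `W A = 1` at units. [folklore] -/
theorem cfW_mul_cfAinv {s : ℂ} (hs : IsUnit (cfW A hA h2 s)) : cfW A hA h2 s * cfAinv A hA h2 s = 1 :=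
  Ring.mul_inverse_cancel _ hs

/-- `A W = 1` at units. [folklore] -/
theorem cfAinv_mul_cfW {s : ℂ} (hs : IsUnit (cfW A hA h2 s)) : cfAinv A hA h2 s * cfW A hA h2 s = 1 :=
  Ring.inverse_mul_cancel _ hs

/-- `s ↦ A(s)` is analytic where `W(s)` is a unit. [folklore] -/
theorem analyticAt_cfAinv {s : ℂ} (hs : IsUnit (cfW A hA h2 s)) : AnalyticAt ℂ (cfAinv A hA h2) s := by
  obtain ⟨u, hu⟩ := hs
  have h1 : AnalyticAt ℂ Ring.inverse (cfW A hA h2 s) := by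
    rw [← hu]
    exact analyticAt_inverse u
  show AnalyticAt ℂ (fun s => Ring.inverse (cfW A hA h2 s)) s
  exact h1.comp (analyticAt_cfW A hA h2 s)

/-- `m(s) = ν(A(s) h)` (the scalar whose zero set `{m = 1}` is the polar set of the resolvent).
[folklore] -/
def cfM (s : ℂ) : ℂ := cfNuL A hA h2 (cfAinv A hA h2 s (cfHL A hA h2))

/-- `m(δ) = 1` (`R₀ h = h`, `ν(h) = 1`). [folklore] -/
theorem cfM_delta : cfM A hA h2 (cfDimension A : ℂ) = 1 := by
  rw [cfM, cfAinv_delta, cfR0_cfHL, cfNuL_cfHL]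

/-- `s ↦ A(s) h` is analytic where `W(s)` is a unit. [folklore] -/
theorem analyticAt_cfAinv_cfHL {s : ℂ} (hs : IsUnit (cfW A hA h2 s)) :
    AnalyticAt ℂ (fun s => cfAinv A hA h2 s (cfHL A hA h2)) s := by
  have h := ((ContinuousLinearMap.apply ℂ CfLip (cfHL A hA h2)).analyticAt _).comp (analyticAt_cfAinv A hA h2 hs)
  simpa only [Function.comp_def, ContinuousLinearMap.apply_apply] using h

/-- `s ↦ m(s)` is analytic where `W(s)` is a unit. [folklore] -/
theorem analyticAt_cfM {s : ℂ} (hs : IsUnit (cfW A hA h2 s)) : AnalyticAt ℂ (cfM A hA h2) s := by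
  have h := ((cfNuL A hA h2).analyticAt _).comp (analyticAt_cfAinv_cfHL A hA h2 hs)
  show AnalyticAt ℂ (fun s => cfNuL A hA h2 (cfAinv A hA h2 s (cfHL A hA h2))) s
  simpa only [Function.comp_def] using h

/-! ### The resolvent by Sherman–Morrison -/

/-- `S₀(s) = ν ⊗ (A(s) h)` (rank one). [folklore] -/
def cfS0 (s : ℂ) : CfLip →L[ℂ] CfLip := (cfNuL A hA h2).smulRight (cfAinv A hA h2 s (cfHL A hA h2))

/-- `A(s) Π = S₀(s)`. [folklore] -/
theorem cfAinv_mul_cfPi (s : ℂ) : cfAinv A hA h2 s * cfPi A hA h2 = cfS0 A hA h2 s := by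
  refine ContinuousLinearMap.ext fun F => ?_
  show cfAinv A hA h2 s (cfPi A hA h2 F) = cfS0 A hA h2 s F
  rw [cfPi_apply, map_smul, cfS0, ContinuousLinearMap.smulRight_apply]

/-- `s ↦ S₀(s)` is analytic where `W(s)` is a unit. [folklore] -/
theorem analyticAt_cfS0 {s : ℂ} (hs : IsUnit (cfW A hA h2 s)) : AnalyticAt ℂ (cfS0 A hA h2) s := by
  have h := ((ContinuousLinearMap.smulRightL ℂ CfLip CfLip (cfNuL A hA h2)).analyticAt _).comp
    (analyticAt_cfAinv_cfHL A hA h2 hs)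
  refine h.congr (Eventually.of_forall fun s => ?_)
  refine ContinuousLinearMap.ext fun F => ?_
  simp only [Function.comp_apply, ContinuousLinearMap.smulRightL_apply_apply, cfS0,
    ContinuousLinearMap.smulRight_apply]

/-- **The resolvent candidate** `R(s) = (1 + (1 - m(s))^{-1} S₀(s)) A(s)`. [folklore] -/
def cfRes (s : ℂ) : CfLip →L[ℂ] CfLip :=
  (1 + (1 - cfM A hA h2 s)⁻¹ • cfS0 A hA h2 s) * cfAinv A hA h2 s

/-- **Sherman–Morrison inversion of `1 - L_s`:** if `W(s)` is a unit and `m(s) ≠ 1` then `R(s)` is a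
two-sided inverse of `1 - L_s`. [cite: MageeOhWinter2019, Prop. 17] -/
theorem cfRes_inverse {s : ℂ} (hs : IsUnit (cfW A hA h2 s)) (hm : cfM A hA h2 s ≠ 1) :
    (1 - cfLOp A hA s) * cfRes A hA h2 s = 1 ∧ cfRes A hA h2 s * (1 - cfLOp A hA s) = 1 := by
  have hW := cfW_mul_cfAinv A hA h2 hs
  have hA' := cfAinv_mul_cfW A hA h2 hs
  have hfac : cfW A hA h2 s - cfPi A hA h2 = cfW A hA h2 s * (1 - cfS0 A hA h2 s) := by
    rw [mul_sub, mul_one, ← cfAinv_mul_cfPi, ← mul_assoc, hW, one_mul]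
  obtain ⟨hJ1, hJ2⟩ := one_sub_smulRight_inverse (cfNuL A hA h2) (cfAinv A hA h2 s (cfHL A hA h2)) hm
  rw [one_sub_cfLOp_eq A hA h2, hfac, cfRes]
  constructor
  · calc cfW A hA h2 s * (1 - cfS0 A hA h2 s) *
          ((1 + (1 - cfM A hA h2 s)⁻¹ • cfS0 A hA h2 s) * cfAinv A hA h2 s)
        = cfW A hA h2 s * ((1 - cfS0 A hA h2 s) * (1 + (1 - cfM A hA h2 s)⁻¹ • cfS0 A hA h2 s)) *
            cfAinv A hA h2 s := by simp only [mul_assoc]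
      _ = 1 := by unfold cfS0 cfM; rw [hJ1, mul_one, hW]
  · calc (1 + (1 - cfM A hA h2 s)⁻¹ • cfS0 A hA h2 s) * cfAinv A hA h2 s *
          (cfW A hA h2 s * (1 - cfS0 A hA h2 s))
        = (1 + (1 - cfM A hA h2 s)⁻¹ • cfS0 A hA h2 s) * (cfAinv A hA h2 s * cfW A hA h2 s) *
            (1 - cfS0 A hA h2 s) := by simp only [mul_assoc]
      _ = 1 := by rw [hA', mul_one]; unfold cfS0 cfM; rw [hJ2]

/-- The resolvent in additive form: `R(s) = A(s) + (1 - m(s))^{-1} S₀(s) A(s)`. [folklore] -/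
theorem cfRes_eq (s : ℂ) :
    cfRes A hA h2 s = cfAinv A hA h2 s + (1 - cfM A hA h2 s)⁻¹ • (cfS0 A hA h2 s * cfAinv A hA h2 s) := by
  rw [cfRes, add_mul, one_mul, smul_mul_assoc]

/-- At `δ`: `S₀(δ) = Π` and `Π R₀ = Π`, so `S₀(δ) A(δ) = Π`. [folklore] -/
theorem cfS0_mul_cfAinv_delta :
    cfS0 A hA h2 (cfDimension A : ℂ) * cfAinv A hA h2 (cfDimension A : ℂ) = cfPi A hA h2 := by
  rw [cfS0, cfAinv_delta, cfR0_cfHL]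
  refine ContinuousLinearMap.ext fun F => ?_
  show (cfNuL A hA h2).smulRight (cfHL A hA h2) (cfR0 A hA h2 F) = cfPi A hA h2 F
  rw [ContinuousLinearMap.smulRight_apply, cfNuL_cfR0, cfPi_apply]

/-! ### The simple pole at `δ` -/

/-- **The resolvent has a simple pole at `s = δ_A` with residue `-m'(δ)^{-1} Π`**
([MageeOhWinter2019, Prop. 17] in operator form; Lalley's renewal theorem, analytic part): if
`m'(δ) ≠ 0` there are `ε > 0` and `W_reg : ℂ → End(CfLip)`, analytic at every point of the ball
`B(δ, ε)`, such that for `0 < |s - δ| < ε` the operator `1 - L_s` is invertible on the Lipschitz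
space with two-sided inverse `W_reg(s) - ((s - δ) m'(δ))^{-1} Π`. [cite: MageeOhWinter2019, Prop. 17] -/
theorem cfResolvent_pole (hk : deriv (cfM A hA h2) (cfDimension A : ℂ) ≠ 0) :
    ∃ ε > 0, ∃ Wreg : ℂ → (CfLip →L[ℂ] CfLip),
      (∀ s ∈ ball (cfDimension A : ℂ) ε, AnalyticAt ℂ Wreg s) ∧
      ∀ s ∈ ball (cfDimension A : ℂ) ε, s ≠ (cfDimension A : ℂ) →
        (1 - cfLOp A hA s) *
            (Wreg s - ((s - cfDimension A)⁻¹ * (deriv (cfM A hA h2) (cfDimension A))⁻¹) • cfPi A hA h2) = 1 ∧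
        (Wreg s - ((s - cfDimension A)⁻¹ * (deriv (cfM A hA h2) (cfDimension A))⁻¹) • cfPi A hA h2) *
            (1 - cfLOp A hA s) = 1 := by
  set δ : ℂ := (cfDimension A : ℂ) with hδ
  -- `g = m - 1`, `k = dslope g δ`
  set g : ℂ → ℂ := fun s => cfM A hA h2 s - 1 with hg
  set k : ℂ → ℂ := dslope g δ with hkdef
  have hgδ : g δ = 0 := by simp only [hg]; rw [cfM_delta, sub_self]
  have hkδ : k δ = deriv (cfM A hA h2) δ := by
    rw [hkdef, dslope_same, hg, deriv_sub_const]
  have hg_an : AnalyticAt ℂ g δ := (analyticAt_cfM A hA h2 (isUnit_cfW_delta A hA h2)).sub analyticAt_const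
  have hk_an_δ : AnalyticAt ℂ k δ := by
    obtain ⟨p, hp⟩ := hg_an
    exact ⟨_, hp.has_fpower_series_dslope_fslope⟩
  have hk_ne : k δ ≠ 0 := by rw [hkδ]; exact hk
  -- the neighbourhood
  have hev : ∀ᶠ s in 𝓝 δ, IsUnit (cfW A hA h2 s) ∧ k s ≠ 0 :=
    (eventually_isUnit_cfW A hA h2).and (hk_an_δ.continuousAt.eventually_ne hk_ne)
  obtain ⟨ε, hε, hball⟩ := Metric.eventually_nhds_iff_ball.1 hev
  -- analyticity of `g`, `k` on the ball
  have hg_an' : ∀ s ∈ ball δ ε, AnalyticAt ℂ g s := fun s hs =>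
    (analyticAt_cfM A hA h2 (hball s hs).1).sub analyticAt_const
  have hk_an : ∀ s ∈ ball δ ε, AnalyticAt ℂ k s := by
    intro s hs
    rcases eq_or_ne s δ with rfl | hne
    · exact hk_an_δ
    · have heq : (fun s => (s - δ)⁻¹ • (g s - g δ)) =ᶠ[𝓝 s] k := by
        filter_upwards [isOpen_ne.mem_nhds hne] with s' hs'
        rw [hkdef, dslope_of_ne _ hs', slope_def_module]
      refine AnalyticAt.congr ?_ heq
      exact ((analyticAt_id.sub analyticAt_const).inv (sub_ne_zero.2 hne)).smul
        ((hg_an' s hs).sub analyticAt_const)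
  -- `Ψ(s) = k(s)⁻¹ • S₀(s) A(s)`
  set Ψ : ℂ → (CfLip →L[ℂ] CfLip) := fun s => (k s)⁻¹ • (cfS0 A hA h2 s * cfAinv A hA h2 s) with hΨ
  have hΨ_an : ∀ s ∈ ball δ ε, AnalyticAt ℂ Ψ s := fun s hs =>
    ((hk_an s hs).inv (hball s hs).2).smul
      ((analyticAt_cfS0 A hA h2 (hball s hs).1).mul (analyticAt_cfAinv A hA h2 (hball s hs).1))
  have hΨδ : Ψ δ = (k δ)⁻¹ • cfPi A hA h2 := by
    simp only [hΨ]
    rw [cfS0_mul_cfAinv_delta]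
  -- the regular part
  set Wreg : ℂ → (CfLip →L[ℂ] CfLip) := fun s => cfAinv A hA h2 s - dslope Ψ δ s with hWreg
  have hWreg_an : ∀ s ∈ ball δ ε, AnalyticAt ℂ Wreg s := by
    intro s hs
    have hd : AnalyticAt ℂ (dslope Ψ δ) s := by
      rcases eq_or_ne s δ with rfl | hne
      · obtain ⟨p, hp⟩ := hΨ_an _ hs
        exact ⟨_, hp.has_fpower_series_dslope_fslope⟩
      · have heq : (fun s => (s - δ)⁻¹ • (Ψ s - Ψ δ)) =ᶠ[𝓝 s] dslope Ψ δ := by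
          filter_upwards [isOpen_ne.mem_nhds hne] with s' hs'
          rw [dslope_of_ne _ hs', slope_def_module]
        refine AnalyticAt.congr ?_ heq
        exact ((analyticAt_id.sub analyticAt_const).inv (sub_ne_zero.2 hne)).smul
          ((hΨ_an s hs).sub analyticAt_const)
    exact (analyticAt_cfAinv A hA h2 (hball s hs).1).sub hd
  refine ⟨ε, hε, Wreg, hWreg_an, fun s hs hne => ?_⟩
  obtain ⟨hsU, hks⟩ := hball s hs
  -- `1 - m(s) = -(s - δ) k(s) ≠ 0`
  have hgs : g s = (s - δ) * k s := by
    have h := sub_smul_dslope g δ s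
    rw [hgδ, sub_zero, smul_eq_mul] at h
    exact h.symm
  have hsδ : s - δ ≠ 0 := sub_ne_zero.2 hne
  have hm1 : 1 - cfM A hA h2 s = -((s - δ) * k s) := by
    have : cfM A hA h2 s - 1 = g s := rfl
    rw [← hgs, ← this]; ring
  have hm : cfM A hA h2 s ≠ 1 := by
    intro h
    have : (s - δ) * k s = 0 := by rw [← hgs]; simp only [hg]; rw [h, sub_self]
    exact (mul_ne_zero hsδ hks) this
  -- the resolvent equals the claimed expression
  have hds : dslope Ψ δ s = (s - δ)⁻¹ • (Ψ s - Ψ δ) := by rw [dslope_of_ne _ hne, slope_def_module]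
  have hkey : cfRes A hA h2 s = Wreg s - ((s - δ)⁻¹ * (deriv (cfM A hA h2) δ)⁻¹) • cfPi A hA h2 := by
    rw [cfRes_eq, hm1, inv_neg, mul_inv]
    simp only [hWreg, hds, hΨδ, hkδ]
    simp only [hΨ]
    module
  rw [← hkey]
  exact cfRes_inverse A hA h2 hsU hm

end Pole

end Literature.NumberTheory.Sieve
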